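import Literature.Analysis.OperatorTheory.Enflo2023.Lemma1
import HarnessLib

/-!
# Enflo (2023), Lemma 1: the printed shape, and a rank-one model where the printed choice of `u₁` fails

Source: P. H. Enflo, *On the invariant subspace problem in Hilbert spaces*, arXiv:2305.15442v2, p.7
(tex L258–L263: `x₀ = (√3/2)u₀ + ½u₁`, "`u₁` is chosen such that `‖T*u₁‖ < (εθ)₀`") and pp.8–9 (LEMMA 1:
"for some `ε`, `0.5 ≥ ε > 0.5 − 10⁻⁵(εθ)₀`, we have `εθ ≤ ½·10⁻⁵(εθ)₀`") — a CLAIMED result under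
adjudication; this file adjudicates one displayed inference, it does not endorse the main theorem.
BLOCK-2b value: certificate / precise gap, not summit progress.  Companion of `Lemma1.lean`.

* `lemma1_printed_shape_of_adjoint_le`, `lemma1_printed_shape_of_ge` — LEMMA 1 in EXACTLY its printed shape
  (half-open interval `0.5 ≥ ε > 0.5 − 10⁻⁵(εθ)₀`, target `εθ ≤ ½·10⁻⁵(εθ)₀`, the minimiser `ℓ'_ε` exists),
  from `Lemma1.lemma1_repaired`: it HOLDS when `‖T*u₁‖ ≤ 10⁻⁶(εθ)₀`, in particular for every unit `u₁ ⟂ u₀`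
  when `(εθ)₀ ≥ 10⁻¹⁴` (using only `‖T*u₁‖ ≤ ‖T‖ ≤ 10⁻²⁰`).
* `Tmodel u₀ u₁ = 10⁻²⁰·⟨u₀, ·⟩u₁` (rank one, `‖T‖ ≤ 10⁻²⁰`, `‖T*u₁‖ ≤ 10⁻²⁰`): for THIS operator the minimiser
  `ℓ'_ε` of (1) for `V_{y₀'}`, `x₀ = (√3/2)u₀ + ½u₁`, is computed from the Lagrange system (5) (`Vy.kkt_coord`):
  `a₀ = c²/(C'+c²)`, `a₁ = (μ/2)/(C'+μ²)` (`c² = 3/4`, `μ = (√3/2)·10⁻²⁰`), and `model_etheta_lower` shows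
  `εθ(ℓ'_ε) ≥ 1.7·10⁻²⁰` for EVERY `ε ∈ [½ − w, ½]`, `0 < w ≤ 10⁻²¹`; and `model_etheta_lower_all` (v2, all
  radii): `εθ(ℓ'_ε) ≥ 0.86·10⁻²⁰` for every `ε ∈ [½ − w, ½]`, `0 < w ≤ 2·10⁻⁴` (AM–GM on
  `εθ ≥ C'(|a₀|² + |a₁|²)` with `|a₁| = μ/(2(C'+μ²))`; the referee's exact minimum is `0.866·10⁻²⁰`).
* `printed_lemma1_fails_in_model`: hence for every `10⁻²⁰ < (εθ)₀ ≤ 10⁻¹⁶` the displayed hypotheses of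
  Lemma 1 hold (`‖T‖ ≤ 10⁻²⁰`, `u₀ ⟂ u₁` unit, `‖T*u₁‖ < (εθ)₀`) and its displayed conclusion FAILS; with
  `printed_lemma1_fails_on_l2` a concrete instance on `ℓ²`; `printed_lemma1_fails_in_model_all` /
  `printed_lemma1_fails_on_l2_all` (v2) extend the refuted range to EVERY `(εθ)₀ ∈ (10⁻²⁰, 1.72·10⁻¹⁵)`
  (`Lemma1.lemma1_printed_of_ge`: the printed choice suffices from `8·10⁻¹⁵`; the band
  `[1.72·10⁻¹⁵, 8·10⁻¹⁵)` is left undecided and is immaterial).  Verdict on the inference p.7+pp.8–9: as printed it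
  does not follow (the proof on p.9 silently uses `‖T*u₁‖ ≪ 10⁻⁵(εθ)₀`, not `< (εθ)₀`); it is REPAIRED by
  sharpening the choice to `‖T*u₁‖ ≤ 10⁻⁶(εθ)₀`, which exists under the standing hypotheses
  (`Lemma1.exists_unit_orthogonal_adjoint_le`).  Caveat, stated not hidden: `Tmodel` is not injective and
  `u₀` is not checked to be "of type 1" ((19)); the model refutes the displayed inference from its displayed
  hypotheses, and the repair makes the question of a rescue by the standing hypotheses moot.

Erratum to the module docstring of `Lemma1.lean`: the first display of p.7 (tex L259) prints `x₀` correctly as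
`(√3/2)u₀ + ½u₁`; only the restatement before Lemma 1 (tex L291) prints `+u₁`.  And the printed target is
`≤ ½·10⁻⁵(εθ)₀` (as delivered), not `< 10⁻⁵(εθ)₀`.
Origin: planner-b2b-enflo-1-g9-0 (formaliser 1, gen 9), 2026-08-19; v2 (all radii) same seat, answering REFEREE.md §29.3.
-/

noncomputable section

open scoped InnerProductSpace ENNReal
open ContinuousLinearMap

namespace Literature.Analysis.OperatorTheory.Enflo2023

namespace Lemma1

open Vy

variable {H : Type*} [NormedAddCommGroup H] [InnerProductSpace ℂ H] [CompleteSpace H]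

/-! ### LEMMA 1 in its printed shape -/

/-- **LEMMA 1, printed shape, with the sharpened `u₁`.**  `‖T‖ ≤ 1/10`, `u₀ ⟂ u₁` unit,
`‖T*u₁‖ ≤ 10⁻⁶(εθ)₀`, `0 < (εθ)₀ ≤ 20`: for some `ε` with `0.5 ≥ ε > 0.5 − 10⁻⁵(εθ)₀` the minimiser `ℓ'_ε`
exists and `εθ(ℓ'_ε) ≤ ½·10⁻⁵(εθ)₀`. [cite: Enflo2023, v2 pp.8–9, Lemma 1] -/
theorem lemma1_printed_shape_of_adjoint_le (T : H →L[ℂ] H) (hT : ‖T‖ < 1) (hT10 : ‖T‖ ≤ 1 / 10)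
    (u₀ u₁ : H) (hu₀ : ‖u₀‖ = 1) (hu₁ : ‖u₁‖ = 1) (h01 : ⟪u₀, u₁⟫_ℂ = 0) {e₀ : ℝ} (he : 0 < e₀)
    (he' : e₀ ≤ 20) (hη : ‖adjoint T u₁‖ ≤ e₀ / 10 ^ 6) :
    ∃ (ε : ℝ) (a : ℓ2), 1 / 2 - e₀ / 10 ^ 5 < ε ∧ ε ≤ 1 / 2 ∧
      IsMinimal (V T hT (yStart u₀)) (xStart u₀ u₁) ε a ∧
      (⟪xStart u₀ u₁ - V T hT (yStart u₀) a, V T hT (yStart u₀) a⟫_ℂ).re ≤ e₀ / (2 * 10 ^ 5) := by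
  -- run the repaired lemma with the slightly smaller target `t = 0.4·10⁻⁵(εθ)₀`
  have ht0 : 0 < 4 * e₀ / 10 ^ 6 := by positivity
  have ht1 : 4 * e₀ / 10 ^ 6 ≤ 1 / 100 := by
    rw [div_le_iff₀ (by positivity)]; linarith
  have hη' : ‖adjoint T u₁‖ ≤ 4 * e₀ / 10 ^ 6 / 4 := by
    have : 4 * e₀ / 10 ^ 6 / 4 = e₀ / 10 ^ 6 := by ring
    linarith
  obtain ⟨ε, a, h1, h2, h3, h4⟩ := lemma1_repaired T hT hT10 u₀ u₁ hu₀ hu₁ h01 ht0 ht1 hη'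
  refine ⟨ε, a, ?_, h2, h3, ?_⟩
  · have : 2 * (4 * e₀ / 10 ^ 6) < e₀ / 10 ^ 5 := by
      have h8 : 2 * (4 * e₀ / 10 ^ 6) = 8 * (e₀ / 10 ^ 6) := by ring
      have h10 : e₀ / 10 ^ 5 = 10 * (e₀ / 10 ^ 6) := by ring
      rw [h8, h10]
      have : 0 < e₀ / 10 ^ 6 := by positivity
      nlinarith
    linarith
  · have : 4 * e₀ / 10 ^ 6 ≤ e₀ / (2 * 10 ^ 5) := by
      have h4 : 4 * e₀ / 10 ^ 6 = 4 * (e₀ / 10 ^ 6) := by ring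
      have h5 : e₀ / (2 * 10 ^ 5) = 5 * (e₀ / 10 ^ 6) := by ring
      rw [h4, h5]
      have : 0 < e₀ / 10 ^ 6 := by positivity
      nlinarith
    linarith

/-- **LEMMA 1, printed shape, for EVERY unit `u₁ ⟂ u₀`, when `(εθ)₀ ≥ 10⁻¹⁴`** (`‖T‖ ≤ 10⁻²⁰`; the only
information about `u₁` used is `‖T*u₁‖ ≤ ‖T‖`). [cite: Enflo2023, v2 pp.8–9, Lemma 1] -/
theorem lemma1_printed_shape_of_ge (T : H →L[ℂ] H) (hT : ‖T‖ < 1) (hT20 : ‖T‖ ≤ 1 / 10 ^ 20)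
    (u₀ u₁ : H) (hu₀ : ‖u₀‖ = 1) (hu₁ : ‖u₁‖ = 1) (h01 : ⟪u₀, u₁⟫_ℂ = 0) {e₀ : ℝ}
    (he : 1 / 10 ^ 14 ≤ e₀) (he' : e₀ ≤ 20) :
    ∃ (ε : ℝ) (a : ℓ2), 1 / 2 - e₀ / 10 ^ 5 < ε ∧ ε ≤ 1 / 2 ∧
      IsMinimal (V T hT (yStart u₀)) (xStart u₀ u₁) ε a ∧
      (⟪xStart u₀ u₁ - V T hT (yStart u₀) a, V T hT (yStart u₀) a⟫_ℂ).re ≤ e₀ / (2 * 10 ^ 5) := by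
  have hT10 : ‖T‖ ≤ 1 / 10 := hT20.trans (by norm_num)
  have hη : ‖adjoint T u₁‖ ≤ e₀ / 10 ^ 6 := by
    have h1 := norm_adjoint_apply_le_opNorm T u₁ hu₁
    have h2 : (1 : ℝ) / 10 ^ 20 ≤ e₀ / 10 ^ 6 := by
      rw [div_le_div_iff₀ (by positivity) (by positivity)]; nlinarith
    linarith
  exact lemma1_printed_shape_of_adjoint_le T hT hT10 u₀ u₁ hu₀ hu₁ h01 (lt_of_lt_of_le (by norm_num) he) he' hη

/-! ### The rank-one model `T = 10⁻²⁰ ⟨u₀, ·⟩ u₁` -/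

/-- The model operator `T x = 10⁻²⁰ ⟪u₀, x⟫ u₁` (so `T u₀ = 10⁻²⁰ u₁`, `T u₁ = 0`, `‖T‖ ≤ 10⁻²⁰` = the standing
`‖T‖` of v2 p.1). [cite: Enflo2023, v2 p.7 (choice of u₁), test operator] -/
def Tmodel (u₀ u₁ : H) : H →L[ℂ] H := ((1 / 10 ^ 20 : ℝ) : ℂ) • (innerSL ℂ u₀).smulRight u₁

omit [CompleteSpace H] in
/-- Unfolding `T x = 10⁻²⁰ ⟪u₀, x⟫ u₁`. [cite: Enflo2023, v2 p.7, test operator] -/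
lemma Tmodel_apply (u₀ u₁ x : H) : Tmodel u₀ u₁ x = ((1 / 10 ^ 20 : ℝ) : ℂ) • (⟪u₀, x⟫_ℂ • u₁) := by
  simp [Tmodel, ContinuousLinearMap.smulRight_apply]

omit [CompleteSpace H] in
/-- `‖T‖ ≤ 10⁻²⁰`. [cite: Enflo2023, v2 p.1 (‖T‖ = 10⁻²⁰), test operator] -/
lemma norm_Tmodel_le (u₀ u₁ : H) (hu₀ : ‖u₀‖ = 1) (hu₁ : ‖u₁‖ = 1) : ‖Tmodel u₀ u₁‖ ≤ 1 / 10 ^ 20 := by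
  refine ContinuousLinearMap.opNorm_le_bound _ (by norm_num) (fun x => ?_)
  rw [Tmodel_apply, norm_smul, norm_smul, Complex.norm_real, Real.norm_of_nonneg (by norm_num), hu₁, mul_one]
  have h := norm_inner_le_norm (𝕜 := ℂ) u₀ x
  rw [hu₀, one_mul] at h
  exact mul_le_mul_of_nonneg_left h (by norm_num)

omit [CompleteSpace H] in
/-- `‖T‖ < 1`. [cite: Enflo2023, v2 p.1, test operator] -/
lemma norm_Tmodel_lt_one (u₀ u₁ : H) (hu₀ : ‖u₀‖ = 1) (hu₁ : ‖u₁‖ = 1) : ‖Tmodel u₀ u₁‖ < 1 :=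
  (norm_Tmodel_le u₀ u₁ hu₀ hu₁).trans_lt (by norm_num)

/-- `‖T*u₁‖ ≤ 10⁻²⁰` — so the printed requirement `‖T*u₁‖ < (εθ)₀` holds as soon as `(εθ)₀ > 10⁻²⁰`. [cite: Enflo2023, v2 p.7, choice of u₁] -/
lemma norm_adjoint_Tmodel_u₁_le (u₀ u₁ : H) (hu₀ : ‖u₀‖ = 1) (hu₁ : ‖u₁‖ = 1) :
    ‖adjoint (Tmodel u₀ u₁) u₁‖ ≤ 1 / 10 ^ 20 :=
  (norm_adjoint_apply_le_opNorm _ u₁ hu₁).trans (norm_Tmodel_le u₀ u₁ hu₀ hu₁)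

omit [CompleteSpace H] in
/-- `T y₀' = μ u₁` with `μ = (√3/2)·10⁻²⁰`. [cite: Enflo2023, v2 p.7, test operator] -/
lemma Tmodel_yStart (u₀ u₁ : H) (hu₀ : ‖u₀‖ = 1) :
    Tmodel u₀ u₁ (yStart u₀) = ((Real.sqrt 3 / 2 * (1 / 10 ^ 20) : ℝ) : ℂ) • u₁ := by
  have h00 : ⟪u₀, u₀⟫_ℂ = 1 := by rw [inner_self_eq_norm_sq_to_K, hu₀]; norm_num
  rw [Tmodel_apply, yStart, inner_smul_right, h00, mul_one, smul_smul]
  congr 1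
  push_cast; ring

omit [CompleteSpace H] in
/-- `T² y₀' = 0` (`T u₁ = 0`). [cite: Enflo2023, v2 p.7, test operator] -/
lemma Tmodel_sq_yStart (u₀ u₁ : H) (hu₀ : ‖u₀‖ = 1) (h01 : ⟪u₀, u₁⟫_ℂ = 0) :
    (Tmodel u₀ u₁ ^ 2) (yStart u₀) = 0 := by
  rw [pow_two, mul_apply_eq_comp, Tmodel_yStart u₀ u₁ hu₀, map_smul, Tmodel_apply, h01,
    zero_smul, smul_zero, smul_zero]

/-- For the model, `V_{y₀'} a = a₀ y₀' + a₁ T y₀'` (all higher powers vanish). [cite: Enflo2023, v2 p.2 eq. (2), test operator] -/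
lemma V_Tmodel (u₀ u₁ : H) (hu₀ : ‖u₀‖ = 1) (h01 : ⟪u₀, u₁⟫_ℂ = 0) (hT : ‖Tmodel u₀ u₁‖ < 1)
    (a : ℓ2) : V (Tmodel u₀ u₁) hT (yStart u₀) a =
      a 0 • yStart u₀ + a 1 • Tmodel u₀ u₁ (yStart u₀) := by
  have h2 := Tmodel_sq_yStart u₀ u₁ hu₀ h01
  have hvan : ∀ j ∉ ({0, 1} : Finset ℕ), a j • (Tmodel u₀ u₁ ^ j) (yStart u₀) = 0 := by
    intro j hj
    have hj2 : 2 ≤ j := by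
      simp only [Finset.mem_insert, Finset.mem_singleton, not_or] at hj
      omega
    obtain ⟨k, rfl⟩ := Nat.exists_eq_add_of_le hj2
    rw [add_comm, pow_add, mul_apply_eq_comp, h2, map_zero, smul_zero]
  rw [V_apply, tsum_eq_sum hvan, Finset.sum_pair (by norm_num), pow_zero, pow_one,
    one_apply_eq_self]

/-- **The minimiser of the model has `εθ ≥ 1.7·10⁻²⁰` throughout the window `[½ − w, ½]`, `0 < w ≤ 10⁻²¹`.**
From (5) in coordinates (`Vy.kkt_coord`): `(C'+c²)a₀ = c²`, `(C'+μ²)a₁ = μ/2`; the active constraint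
`c²|1−a₀|² + |½ − μa₁|² = ε² ∈ [(½−w)², ¼]` forces `1.87·10⁻²⁰ ≤ C' ≤ 10⁻¹³`, and `εθ = C'‖a‖² ≥ C'|a₀|²`. [cite: Enflo2023, v2 p.3 eq. (5)–(6), pp.8–9 Lemma 1, test operator] -/
theorem model_etheta_lower (u₀ u₁ : H) (hu₀ : ‖u₀‖ = 1) (hu₁ : ‖u₁‖ = 1) (h01 : ⟪u₀, u₁⟫_ℂ = 0)
    (hT : ‖Tmodel u₀ u₁‖ < 1) {w ε : ℝ} (hw0 : 0 < w) (hw1 : w ≤ 1 / 10 ^ 21)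
    (hε1 : 1 / 2 - w ≤ ε) (hε2 : ε ≤ 1 / 2) (a : ℓ2)
    (ha : IsMinimal (V (Tmodel u₀ u₁) hT (yStart u₀)) (xStart u₀ u₁) ε a) :
    1.7 / 10 ^ 20 ≤
      (⟪xStart u₀ u₁ - V (Tmodel u₀ u₁) hT (yStart u₀) a, V (Tmodel u₀ u₁) hT (yStart u₀) a⟫_ℂ).re := by
  -- constants: c = √3/2 (c² = 3/4), μ = c·10⁻²⁰ (μ² = m2 = 0.75·10⁻⁴⁰)
  have hc2 : (Real.sqrt 3 / 2) ^ 2 = 3 / 4 := by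
    rw [div_pow, Real.sq_sqrt (by norm_num)]; norm_num
  have hc0 : 0 < Real.sqrt 3 / 2 := by positivity
  have hμ0 : 0 < Real.sqrt 3 / 2 * (1 / 10 ^ 20) := by positivity
  have hμ2 : (Real.sqrt 3 / 2 * (1 / 10 ^ 20)) ^ 2 = 3 / 4 / 10 ^ 40 := by
    rw [mul_pow, hc2]; norm_num
  have h00 : ⟪u₀, u₀⟫_ℂ = 1 := by rw [inner_self_eq_norm_sq_to_K, hu₀]; norm_num
  have h11 : ⟪u₁, u₁⟫_ℂ = 1 := by rw [inner_self_eq_norm_sq_to_K, hu₁]; norm_num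
  have h10 : ⟪u₁, u₀⟫_ℂ = 0 := by rw [← inner_conj_symm, h01, map_zero]
  have hx1 : ‖xStart u₀ u₁‖ = 1 := norm_xStart u₀ u₁ hu₀ hu₁ h01
  have hTy := Tmodel_yStart u₀ u₁ hu₀
  have hV := V_Tmodel u₀ u₁ hu₀ h01 hT a
  -- the Lagrange system (5)
  have hane : a ≠ 0 := ha.ne_zero (by rw [hx1]; linarith)
  obtain ⟨C, hC0, hC⟩ := ha.kkt hane
  have hk0 := kkt_coord (Tmodel u₀ u₁) hT (yStart u₀) (xStart u₀ u₁) a hC 0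
  have hk1 := kkt_coord (Tmodel u₀ u₁) hT (yStart u₀) (xStart u₀ u₁) a hC 1
  -- name the constants (opaque from here on)
  obtain ⟨c, hc⟩ : ∃ c : ℝ, Real.sqrt 3 / 2 = c := ⟨_, rfl⟩
  obtain ⟨m2, hm2⟩ : ∃ m2 : ℝ, (3 : ℝ) / 4 / 10 ^ 40 = m2 := ⟨_, rfl⟩
  rw [hc] at hc2 hc0 hμ0 hμ2 hTy
  obtain ⟨μ, hμ⟩ : ∃ μ : ℝ, c * (1 / 10 ^ 20) = μ := ⟨_, rfl⟩
  rw [hμ] at hμ0 hμ2 hTy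
  rw [hm2] at hμ2
  have hm2pos : 0 < m2 := by rw [← hm2]; positivity
  -- the residual vector in the frame
  have hdiff : xStart u₀ u₁ - V (Tmodel u₀ u₁) hT (yStart u₀) a =
      ((c : ℂ) * (1 - a 0)) • u₀ + ((1 / 2 : ℂ) - a 1 * μ) • u₁ := by
    rw [hV, hTy]
    simp only [xStart, yStart, hc, smul_smul]
    push_cast
    module
  rw [pow_zero, one_apply_eq_self, hdiff, yStart, hc, inner_smul_left, inner_add_right,
    inner_smul_right, inner_smul_right, h00, h01, Complex.conj_ofReal] at hk0
  rw [pow_one, hTy, hdiff, inner_smul_left, inner_add_right, inner_smul_right, inner_smul_right, h10,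
    h11, Complex.conj_ofReal] at hk1
  -- solve: (C+c²)a₀ = c², (C+c²)(1−a₀) = C, (C+μ²)(½ − μa₁) = C/2
  have hE0 : ((C + c ^ 2 : ℝ) : ℂ) * a 0 = ((c ^ 2 : ℝ) : ℂ) := by
    push_cast; linear_combination (-1 : ℂ) * hk0
  have hE0' : ((C + c ^ 2 : ℝ) : ℂ) * (1 - a 0) = (C : ℂ) := by
    push_cast; linear_combination hk0
  have hE1' : ((C + μ ^ 2 : ℝ) : ℂ) * ((1 / 2 : ℂ) - a 1 * μ) = ((C / 2 : ℝ) : ℂ) := by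
    push_cast; linear_combination (μ : ℂ) * hk1
  -- norms: s = |a₀|, p = |1 − a₀|, q = |½ − μ a₁|
  obtain ⟨s, hs⟩ : ∃ s : ℝ, ‖a 0‖ = s := ⟨_, rfl⟩
  obtain ⟨p, hp⟩ : ∃ p : ℝ, ‖(1 : ℂ) - a 0‖ = p := ⟨_, rfl⟩
  obtain ⟨q, hq⟩ : ∃ q : ℝ, ‖(1 / 2 : ℂ) - a 1 * μ‖ = q := ⟨_, rfl⟩
  have hs0 : 0 ≤ s := by rw [← hs]; exact norm_nonneg _
  have hp0 : 0 ≤ p := by rw [← hp]; exact norm_nonneg _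
  have hq0 : 0 ≤ q := by rw [← hq]; exact norm_nonneg _
  have hCc : 0 < C + c ^ 2 := by positivity
  have hCm : 0 < C + μ ^ 2 := by positivity
  have hR1 : (C + c ^ 2) * s = c ^ 2 := by
    have h := congrArg (fun z : ℂ => ‖z‖) hE0
    simp only [norm_mul, Complex.norm_real, Real.norm_of_nonneg hCc.le,
      Real.norm_of_nonneg (sq_nonneg c), hs] at h
    exact h
  have hR2 : (C + c ^ 2) * p = C := by
    have h := congrArg (fun z : ℂ => ‖z‖) hE0'
    simp only [norm_mul, Complex.norm_real, Real.norm_of_nonneg hCc.le, Real.norm_of_nonneg hC0,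
      hp] at h
    exact h
  have hR3 : (C + μ ^ 2) * q = C / 2 := by
    have h := congrArg (fun z : ℂ => ‖z‖) hE1'
    simp only [norm_mul, Complex.norm_real, Real.norm_of_nonneg hCm.le,
      Real.norm_of_nonneg (by positivity : (0:ℝ) ≤ C / 2), hq] at h
    exact h
  -- the active constraint: ε² = c²p² + q²
  have hact : ‖xStart u₀ u₁ - V (Tmodel u₀ u₁) hT (yStart u₀) a‖ = ε :=
    ha.norm_sub_eq (by rw [hx1]; linarith)
  have hε : ε ^ 2 = c ^ 2 * p ^ 2 + q ^ 2 := by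
    have h := norm_sq_two_frame u₀ u₁ hu₀ hu₁ h01 ((c : ℂ) * (1 - a 0)) ((1 / 2 : ℂ) - a 1 * μ)
    rw [← hdiff, hact, norm_mul, Complex.norm_real, Real.norm_of_nonneg hc0.le, mul_pow, hp, hq] at h
    exact h
  -- εθ = C‖a‖² ≥ C s²
  have hθ : (⟪xStart u₀ u₁ - V (Tmodel u₀ u₁) hT (yStart u₀) a,
      V (Tmodel u₀ u₁) hT (yStart u₀) a⟫_ℂ).re = C * ‖a‖ ^ 2 := by
    rw [IsMinimal.eq6 hC, Complex.ofReal_re]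
  have hsa : s ^ 2 ≤ ‖a‖ ^ 2 := by
    have h := sum_sq_le a {0}
    rw [Finset.sum_singleton, hs] at h
    exact h
  -- real algebra, with c² = 3/4 and μ² = m2
  rw [hc2] at hR1 hR2 hε
  rw [hμ2] at hR3
  have hε0 : 0 ≤ ε := ha.eps_nonneg
  have hCm2pos : 0 < C + m2 := by linarith
  have hup : 3 / 4 * p ^ 2 + q ^ 2 ≤ 1 / 4 := by
    have h := pow_le_pow_left₀ hε0 hε2 2
    linarith only [h, hε]
  have hlo : 1 / 4 - w ≤ 3 / 4 * p ^ 2 + q ^ 2 := by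
    have h := pow_le_pow_left₀ (by linarith) hε1 2
    nlinarith only [h, hε, sq_nonneg w]
  have hqC : (C + m2) ^ 2 * q ^ 2 = C ^ 2 / 4 := by
    have h : ((C + m2) * q) ^ 2 = (C / 2) ^ 2 := by rw [hR3]
    linear_combination h
  -- (A1): 3p²(C+m2)² ≤ m2(2C+m2)
  have hA1 : 3 * p ^ 2 * (C + m2) ^ 2 ≤ m2 * (2 * C + m2) := by
    have h := mul_le_mul_of_nonneg_left hup (mul_nonneg (by norm_num : (0:ℝ) ≤ 4) (sq_nonneg (C + m2)))
    linear_combination h - 4 * hqC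
  have hm2small : m2 ≤ 1 / 10 ^ 40 := by rw [← hm2]; norm_num
  have hRHS : m2 * (2 * C + m2) ≤ 1 / 10 ^ 40 * (2 * C + 1 / 10 ^ 40) :=
    mul_le_mul hm2small (by linarith) (by linarith) (by norm_num)
  have hCm2sq : C ^ 2 ≤ (C + m2) ^ 2 := pow_le_pow_left₀ hC0 (by linarith) 2
  -- C ≤ 3/4
  have hCle : C ≤ 3 / 4 := by
    by_contra h
    push Not at h
    have h1 : (C + 3 / 4) * (p - 1 / 2) = (C - 3 / 4) / 2 := by linear_combination hR2
    have hp12 : 1 / 2 ≤ p := by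
      by_contra hlt
      push Not at hlt
      have hneg : (C + 3 / 4) * (p - 1 / 2) < 0 := mul_neg_of_pos_of_neg (by linarith) (by linarith)
      rw [h1] at hneg
      linarith
    have hp2 : 1 / 4 ≤ p ^ 2 := by
      have := pow_le_pow_left₀ (by norm_num) hp12 2
      linarith only [this]
    have h3 : 3 / 4 * (C + m2) ^ 2 ≤ 3 * p ^ 2 * (C + m2) ^ 2 :=
      mul_le_mul_of_nonneg_right (by linarith only [hp2]) (sq_nonneg (C + m2))
    have h4 : 3 / 4 * (C + m2) ^ 2 ≤ m2 * (2 * C + m2) := h3.trans hA1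
    have hCC : 3 / 4 * C ≤ C ^ 2 := by nlinarith only [h]
    linarith only [h, hCC, hCm2sq, h4, hRHS]
  -- C ≤ 10⁻¹³
  have hCk : C ≤ 1 / 10 ^ 13 := by
    by_contra h
    push Not at h
    have hCsq : C ^ 2 ≤ 3 / 4 * C := by nlinarith only [hCle, hC0]
    have hp23 : 2 / 3 * C ≤ p := by
      by_contra hlt
      push Not at hlt
      have h1 := mul_lt_mul_of_pos_left hlt (by linarith : (0:ℝ) < C + 3 / 4)
      rw [hR2] at h1
      nlinarith only [h1, hCsq, h]
    have hp2 : (2 / 3 * C) ^ 2 ≤ p ^ 2 := pow_le_pow_left₀ (by linarith) hp23 2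
    have h4 : (2 / 3 * C) ^ 2 * C ^ 2 ≤ p ^ 2 * (C + m2) ^ 2 :=
      mul_le_mul hp2 hCm2sq (sq_nonneg C) (sq_nonneg p)
    have h5 : 4 / 3 * (C ^ 3 * C) ≤ m2 * (2 * C + m2) := by linarith only [h4, hA1]
    have h6 : ((1 : ℝ) / 10 ^ 13) ^ 3 ≤ C ^ 3 := pow_le_pow_left₀ (by positivity) h.le 3
    have h7 : ((1 : ℝ) / 10 ^ 13) ^ 3 * C ≤ C ^ 3 * C := mul_le_mul_of_nonneg_right h6 hC0
    linarith only [h5, h7, hRHS, h]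
  -- lower bound on C from ε ≥ ½ − w
  have hp_up : p ≤ 4 / 3 * C := by
    have h := mul_nonneg hC0 hp0
    linarith only [h, hR2]
  have hp2_up : 3 / 4 * p ^ 2 ≤ 4 / 3 * ((1 : ℝ) / 10 ^ 13) ^ 2 := by
    have h1 : p ≤ 4 / 3 * (1 / 10 ^ 13) := hp_up.trans (by linarith only [hCk])
    have h2 := pow_le_pow_left₀ hp0 h1 2
    linarith only [h2]
  have hq_lo : 1 / 4 - q ^ 2 ≤ w + 4 / 3 * ((1 : ℝ) / 10 ^ 13) ^ 2 := by
    linarith only [hlo, hp2_up]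
  have hkey : m2 * (C + m2) ≤ 4 * (C + m2) ^ 2 * (1 / 4 - q ^ 2) := by
    have h1 : 4 * (C + m2) ^ 2 * (1 / 4 - q ^ 2) = m2 * (2 * C + m2) := by
      linear_combination (-4) * hqC
    rw [h1]
    have h2 := mul_nonneg hC0 hm2pos.le
    linarith only [h2]
  have hE : m2 ≤ 4 * (C + m2) * (w + 4 / 3 * ((1 : ℝ) / 10 ^ 13) ^ 2) := by
    have h1 : m2 ≤ 4 * (C + m2) * (1 / 4 - q ^ 2) := by
      have h' : (C + m2) * m2 ≤ (C + m2) * (4 * (C + m2) * (1 / 4 - q ^ 2)) := by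
        linarith only [hkey]
      exact le_of_mul_le_mul_left h' hCm2pos
    exact h1.trans (mul_le_mul_of_nonneg_left hq_lo (by linarith))
  have hClo : 1.87 / 10 ^ 20 ≤ C := by
    have h1 : 4 * (C + m2) * (w + 4 / 3 * ((1 : ℝ) / 10 ^ 13) ^ 2) ≤
        4 * (C + m2) * (1 / 10 ^ 21 + 4 / 3 * ((1 : ℝ) / 10 ^ 13) ^ 2) :=
      mul_le_mul_of_nonneg_left (by linarith only [hw1]) (by linarith)
    have h2 := hE.trans h1
    rw [← hm2] at h2
    linarith only [h2]
  -- s ≥ 1 − (4/3)·10⁻¹³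
  have hs1 : s ≤ 1 := by
    have h := mul_nonneg hC0 hs0
    linarith only [h, hR1]
  have hCs : C * s ≤ C := by nlinarith only [hs1, hC0]
  have hs_lo : 1 - 4 / 3 * ((1 : ℝ) / 10 ^ 13) ≤ s := by linarith only [hR1, hCs, hCk]
  have hs2 : (1 - 4 / 3 * ((1 : ℝ) / 10 ^ 13)) ^ 2 ≤ s ^ 2 :=
    pow_le_pow_left₀ (by norm_num) hs_lo 2
  have hfin : 1.7 / 10 ^ 20 ≤ C * s ^ 2 := by
    have h := mul_le_mul hClo hs2 (by positivity) hC0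
    linarith only [h]
  rw [hθ]
  calc (1.7 : ℝ) / 10 ^ 20 ≤ C * s ^ 2 := hfin
    _ ≤ C * ‖a‖ ^ 2 := mul_le_mul_of_nonneg_left hsa hC0

/-- **The printed Lemma 1 fails in the model.**  For every `10⁻²⁰ < (εθ)₀ ≤ 10⁻¹⁶`: `‖T‖ ≤ 10⁻²⁰`, `u₀ ⟂ u₁`
unit, `‖T*u₁‖ < (εθ)₀` (the displayed hypotheses of p.7/pp.8–9), and yet NO `ε` with
`0.5 ≥ ε > 0.5 − 10⁻⁵(εθ)₀` has `εθ(ℓ'_ε) ≤ ½·10⁻⁵(εθ)₀` (the minimiser has `εθ ≥ 1.7·10⁻²⁰ > ½·10⁻⁵(εθ)₀`). [cite: Enflo2023, v2 p.7 (choice of u₁), pp.8–9 Lemma 1] -/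
theorem printed_lemma1_fails_in_model (u₀ u₁ : H) (hu₀ : ‖u₀‖ = 1) (hu₁ : ‖u₁‖ = 1)
    (h01 : ⟪u₀, u₁⟫_ℂ = 0) (hT : ‖Tmodel u₀ u₁‖ < 1) {e₀ : ℝ} (he0 : 1 / 10 ^ 20 < e₀)
    (he1 : e₀ ≤ 1 / 10 ^ 16) :
    ‖Tmodel u₀ u₁‖ ≤ 1 / 10 ^ 20 ∧ ‖adjoint (Tmodel u₀ u₁) u₁‖ < e₀ ∧
    ¬ ∃ (ε : ℝ) (a : ℓ2), 1 / 2 - e₀ / 10 ^ 5 < ε ∧ ε ≤ 1 / 2 ∧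
        IsMinimal (V (Tmodel u₀ u₁) hT (yStart u₀)) (xStart u₀ u₁) ε a ∧
        (⟪xStart u₀ u₁ - V (Tmodel u₀ u₁) hT (yStart u₀) a, V (Tmodel u₀ u₁) hT (yStart u₀) a⟫_ℂ).re
          ≤ e₀ / (2 * 10 ^ 5) := by
  refine ⟨norm_Tmodel_le u₀ u₁ hu₀ hu₁, (norm_adjoint_Tmodel_u₁_le u₀ u₁ hu₀ hu₁).trans_lt he0, ?_⟩
  rintro ⟨ε, a, h1, h2, ha, hθ⟩
  have hw0 : 0 < e₀ / 10 ^ 5 := by positivity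
  have hw1 : e₀ / 10 ^ 5 ≤ 1 / 10 ^ 21 := by
    rw [div_le_div_iff₀ (by positivity) (by positivity)]; nlinarith
  have h := model_etheta_lower u₀ u₁ hu₀ hu₁ h01 hT hw0 hw1 h1.le h2 a ha
  have : e₀ / (2 * 10 ^ 5) < 1.7 / 10 ^ 20 := by
    rw [div_lt_div_iff₀ (by positivity) (by positivity)]; nlinarith
  linarith

/-- **Concrete instance on `ℓ²`** (`u₀ = e₀`, `u₁ = e₁`): an operator of norm `≤ 10⁻²⁰` on a separable
infinite-dimensional Hilbert space and an orthonormal pair for which the displayed hypotheses of Lemma 1 hold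
with `(εθ)₀ = 10⁻¹⁶` and the displayed conclusion fails. [cite: Enflo2023, v2 p.7, pp.8–9 Lemma 1] -/
theorem printed_lemma1_fails_on_l2 :
    ∃ (u₀ u₁ : ℓ2) (hu : ‖Tmodel u₀ u₁‖ < 1), ‖u₀‖ = 1 ∧ ‖u₁‖ = 1 ∧ ⟪u₀, u₁⟫_ℂ = 0 ∧
      ‖Tmodel u₀ u₁‖ ≤ 1 / 10 ^ 20 ∧ ‖adjoint (Tmodel u₀ u₁) u₁‖ < 1 / 10 ^ 16 ∧
      ¬ ∃ (ε : ℝ) (a : ℓ2), 1 / 2 - (1 / 10 ^ 16) / 10 ^ 5 < ε ∧ ε ≤ 1 / 2 ∧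
        IsMinimal (V (Tmodel u₀ u₁) hu (yStart u₀)) (xStart u₀ u₁) ε a ∧
        (⟪xStart u₀ u₁ - V (Tmodel u₀ u₁) hu (yStart u₀) a, V (Tmodel u₀ u₁) hu (yStart u₀) a⟫_ℂ).re
          ≤ (1 / 10 ^ 16) / (2 * 10 ^ 5) := by
  classical
  set u₀ : ℓ2 := lp.single 2 0 (1 : ℂ) with hu₀def
  set u₁ : ℓ2 := lp.single 2 1 (1 : ℂ) with hu₁def
  have hn₀ : ‖u₀‖ = 1 := by rw [hu₀def, lp.norm_single (by norm_num)]; simp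
  have hn₁ : ‖u₁‖ = 1 := by rw [hu₁def, lp.norm_single (by norm_num)]; simp
  have h01 : ⟪u₀, u₁⟫_ℂ = 0 := by
    rw [hu₀def, lp.inner_single_left, hu₁def, lp.single_apply,
      Pi.single_eq_of_ne (by norm_num : (0 : ℕ) ≠ 1), inner_zero_right]
  have hT := norm_Tmodel_lt_one u₀ u₁ hn₀ hn₁
  obtain ⟨h1, h2, h3⟩ := printed_lemma1_fails_in_model u₀ u₁ hn₀ hn₁ h01 hT
    (by norm_num : (1 : ℝ) / 10 ^ 20 < 1 / 10 ^ 16) le_rfl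
  exact ⟨u₀, u₁, hT, hn₀, hn₁, h01, h1, h2, h3⟩


/-! ### The model at every radius of the printed window: `εθ ≥ 0.86·10⁻²⁰`, so the printed Lemma 1 fails for
all `(εθ)₀ < 1.72·10⁻¹⁵` (the referee's §29.3 range, kernel form) -/

/-- **All radii.**  In the model, every minimiser at every radius `ε ∈ [½ − w, ½]` with `0 < w ≤ 2·10⁻⁴` has
`εθ ≥ 0.86·10⁻²⁰` (AM–GM: `εθ ≥ C'(|a₀|² + |a₁|²)` with `|a₀| ≈ 1`, `|a₁| = μ/(2(C'+μ²))`, so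
`εθ ≳ C' + μ²/(4C') ≥ μ = (√3/2)10⁻²⁰`; the referee's exact minimum is `0.866·10⁻²⁰`).
[cite: Enflo2023, v2 p.3 eq. (5)–(6), pp.8–9 Lemma 1, test operator] -/
theorem model_etheta_lower_all (u₀ u₁ : H) (hu₀ : ‖u₀‖ = 1) (hu₁ : ‖u₁‖ = 1) (h01 : ⟪u₀, u₁⟫_ℂ = 0)
    (hT : ‖Tmodel u₀ u₁‖ < 1) {w ε : ℝ} (hw0 : 0 < w) (hw1 : w ≤ 2 / 10 ^ 4)
    (hε1 : 1 / 2 - w ≤ ε) (hε2 : ε ≤ 1 / 2) (a : ℓ2)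
    (ha : IsMinimal (V (Tmodel u₀ u₁) hT (yStart u₀)) (xStart u₀ u₁) ε a) :
    0.86 / 10 ^ 20 ≤
      (⟪xStart u₀ u₁ - V (Tmodel u₀ u₁) hT (yStart u₀) a, V (Tmodel u₀ u₁) hT (yStart u₀) a⟫_ℂ).re := by
  -- constants: c = √3/2 (c² = 3/4), μ = c·10⁻²⁰ (μ² = m2 = 0.75·10⁻⁴⁰)
  have hc2 : (Real.sqrt 3 / 2) ^ 2 = 3 / 4 := by
    rw [div_pow, Real.sq_sqrt (by norm_num)]; norm_num
  have hc0 : 0 < Real.sqrt 3 / 2 := by positivity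
  have hμ0 : 0 < Real.sqrt 3 / 2 * (1 / 10 ^ 20) := by positivity
  have hμ2 : (Real.sqrt 3 / 2 * (1 / 10 ^ 20)) ^ 2 = 3 / 4 / 10 ^ 40 := by
    rw [mul_pow, hc2]; norm_num
  have h00 : ⟪u₀, u₀⟫_ℂ = 1 := by rw [inner_self_eq_norm_sq_to_K, hu₀]; norm_num
  have h11 : ⟪u₁, u₁⟫_ℂ = 1 := by rw [inner_self_eq_norm_sq_to_K, hu₁]; norm_num
  have h10 : ⟪u₁, u₀⟫_ℂ = 0 := by rw [← inner_conj_symm, h01, map_zero]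
  have hx1 : ‖xStart u₀ u₁‖ = 1 := norm_xStart u₀ u₁ hu₀ hu₁ h01
  have hTy := Tmodel_yStart u₀ u₁ hu₀
  have hV := V_Tmodel u₀ u₁ hu₀ h01 hT a
  -- the Lagrange system (5)
  have hane : a ≠ 0 := ha.ne_zero (by rw [hx1]; linarith)
  obtain ⟨C, hC0, hC⟩ := ha.kkt hane
  have hk0 := kkt_coord (Tmodel u₀ u₁) hT (yStart u₀) (xStart u₀ u₁) a hC 0
  have hk1 := kkt_coord (Tmodel u₀ u₁) hT (yStart u₀) (xStart u₀ u₁) a hC 1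
  -- name the constants (opaque from here on)
  obtain ⟨c, hc⟩ : ∃ c : ℝ, Real.sqrt 3 / 2 = c := ⟨_, rfl⟩
  obtain ⟨m2, hm2⟩ : ∃ m2 : ℝ, (3 : ℝ) / 4 / 10 ^ 40 = m2 := ⟨_, rfl⟩
  rw [hc] at hc2 hc0 hμ0 hμ2 hTy
  obtain ⟨μ, hμ⟩ : ∃ μ : ℝ, c * (1 / 10 ^ 20) = μ := ⟨_, rfl⟩
  rw [hμ] at hμ0 hμ2 hTy
  rw [hm2] at hμ2
  have hm2pos : 0 < m2 := by rw [← hm2]; positivity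
  -- the residual vector in the frame
  have hdiff : xStart u₀ u₁ - V (Tmodel u₀ u₁) hT (yStart u₀) a =
      ((c : ℂ) * (1 - a 0)) • u₀ + ((1 / 2 : ℂ) - a 1 * μ) • u₁ := by
    rw [hV, hTy]
    simp only [xStart, yStart, hc, smul_smul]
    push_cast
    module
  rw [pow_zero, one_apply_eq_self, hdiff, yStart, hc, inner_smul_left, inner_add_right,
    inner_smul_right, inner_smul_right, h00, h01, Complex.conj_ofReal] at hk0
  rw [pow_one, hTy, hdiff, inner_smul_left, inner_add_right, inner_smul_right, inner_smul_right, h10,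
    h11, Complex.conj_ofReal] at hk1
  -- solve: (C+c²)a₀ = c², (C+c²)(1−a₀) = C, (C+μ²)(½ − μa₁) = C/2, (C+μ²)·a₁·μ = μ²/2
  have hE0 : ((C + c ^ 2 : ℝ) : ℂ) * a 0 = ((c ^ 2 : ℝ) : ℂ) := by
    push_cast; linear_combination (-1 : ℂ) * hk0
  have hE0' : ((C + c ^ 2 : ℝ) : ℂ) * (1 - a 0) = (C : ℂ) := by
    push_cast; linear_combination hk0
  have hE1' : ((C + μ ^ 2 : ℝ) : ℂ) * ((1 / 2 : ℂ) - a 1 * μ) = ((C / 2 : ℝ) : ℂ) := by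
    push_cast; linear_combination (μ : ℂ) * hk1
  have hE2 : ((C + μ ^ 2 : ℝ) : ℂ) * (a 1 * μ) = ((μ ^ 2 / 2 : ℝ) : ℂ) := by
    push_cast; linear_combination (-(μ : ℂ)) * hk1
  -- norms: s = |a₀|, p = |1 − a₀|, q = |½ − μ a₁|, r = |a₁|
  obtain ⟨s, hs⟩ : ∃ s : ℝ, ‖a 0‖ = s := ⟨_, rfl⟩
  obtain ⟨p, hp⟩ : ∃ p : ℝ, ‖(1 : ℂ) - a 0‖ = p := ⟨_, rfl⟩
  obtain ⟨q, hq⟩ : ∃ q : ℝ, ‖(1 / 2 : ℂ) - a 1 * μ‖ = q := ⟨_, rfl⟩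
  obtain ⟨r, hr⟩ : ∃ r : ℝ, ‖a 1‖ = r := ⟨_, rfl⟩
  have hs0 : 0 ≤ s := by rw [← hs]; exact norm_nonneg _
  have hp0 : 0 ≤ p := by rw [← hp]; exact norm_nonneg _
  have hq0 : 0 ≤ q := by rw [← hq]; exact norm_nonneg _
  have hr0 : 0 ≤ r := by rw [← hr]; exact norm_nonneg _
  have hCc : 0 < C + c ^ 2 := by positivity
  have hCm : 0 < C + μ ^ 2 := by positivity
  have hR1 : (C + c ^ 2) * s = c ^ 2 := by
    have h := congrArg (fun z : ℂ => ‖z‖) hE0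
    simp only [norm_mul, Complex.norm_real, Real.norm_of_nonneg hCc.le,
      Real.norm_of_nonneg (sq_nonneg c), hs] at h
    exact h
  have hR2 : (C + c ^ 2) * p = C := by
    have h := congrArg (fun z : ℂ => ‖z‖) hE0'
    simp only [norm_mul, Complex.norm_real, Real.norm_of_nonneg hCc.le, Real.norm_of_nonneg hC0,
      hp] at h
    exact h
  have hR3 : (C + μ ^ 2) * q = C / 2 := by
    have h := congrArg (fun z : ℂ => ‖z‖) hE1'
    simp only [norm_mul, Complex.norm_real, Real.norm_of_nonneg hCm.le,
      Real.norm_of_nonneg (by positivity : (0:ℝ) ≤ C / 2), hq] at h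
    exact h
  have hR4 : (C + μ ^ 2) * (r * μ) = μ ^ 2 / 2 := by
    have h := congrArg (fun z : ℂ => ‖z‖) hE2
    simp only [norm_mul, Complex.norm_real, Real.norm_of_nonneg hCm.le, Real.norm_of_nonneg hμ0.le,
      Real.norm_of_nonneg (by positivity : (0:ℝ) ≤ μ ^ 2 / 2), hr] at h
    exact h
  have hR4' : (C + μ ^ 2) * r = μ / 2 := by
    have h : ((C + μ ^ 2) * r) * μ = (μ / 2) * μ := by
      rw [mul_assoc, hR4]; ring
    exact mul_right_cancel₀ hμ0.ne' h
  -- the active constraint: ε² = c²p² + q²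
  have hact : ‖xStart u₀ u₁ - V (Tmodel u₀ u₁) hT (yStart u₀) a‖ = ε :=
    ha.norm_sub_eq (by rw [hx1]; linarith)
  have hε : ε ^ 2 = c ^ 2 * p ^ 2 + q ^ 2 := by
    have h := norm_sq_two_frame u₀ u₁ hu₀ hu₁ h01 ((c : ℂ) * (1 - a 0)) ((1 / 2 : ℂ) - a 1 * μ)
    rw [← hdiff, hact, norm_mul, Complex.norm_real, Real.norm_of_nonneg hc0.le, mul_pow, hp, hq] at h
    exact h
  -- εθ = C‖a‖² ≥ C (s² + r²)
  have hθ : (⟪xStart u₀ u₁ - V (Tmodel u₀ u₁) hT (yStart u₀) a,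
      V (Tmodel u₀ u₁) hT (yStart u₀) a⟫_ℂ).re = C * ‖a‖ ^ 2 := by
    rw [IsMinimal.eq6 hC, Complex.ofReal_re]
  have hsra : s ^ 2 + r ^ 2 ≤ ‖a‖ ^ 2 := by
    have h := sum_sq_le a {0, 1}
    rw [Finset.sum_pair (by norm_num), hs, hr] at h
    exact h
  -- real algebra, with c² = 3/4 and μ² = m2
  rw [hc2] at hR1 hR2 hε
  rw [hμ2] at hR3 hR4'
  have hε0 : 0 ≤ ε := ha.eps_nonneg
  have hCm2pos : 0 < C + m2 := by linarith
  have hup : 3 / 4 * p ^ 2 + q ^ 2 ≤ 1 / 4 := by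
    have h := pow_le_pow_left₀ hε0 hε2 2
    linarith only [h, hε]
  have hlo : 1 / 4 - w ≤ 3 / 4 * p ^ 2 + q ^ 2 := by
    have h := pow_le_pow_left₀ (by linarith) hε1 2
    nlinarith only [h, hε, sq_nonneg w]
  have hqC : (C + m2) ^ 2 * q ^ 2 = C ^ 2 / 4 := by
    have h : ((C + m2) * q) ^ 2 = (C / 2) ^ 2 := by rw [hR3]
    linear_combination h
  have hrC : (C + m2) ^ 2 * r ^ 2 = m2 / 4 := by
    have h : ((C + m2) * r) ^ 2 = (μ / 2) ^ 2 := by rw [hR4']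
    have h2 : (μ / 2) ^ 2 = μ ^ 2 / 4 := by ring
    rw [h2, hμ2] at h
    linear_combination h
  -- (A1): 3p²(C+m2)² ≤ m2(2C+m2)
  have hA1 : 3 * p ^ 2 * (C + m2) ^ 2 ≤ m2 * (2 * C + m2) := by
    have h := mul_le_mul_of_nonneg_left hup (mul_nonneg (by norm_num : (0:ℝ) ≤ 4) (sq_nonneg (C + m2)))
    linear_combination h - 4 * hqC
  have hm2small : m2 ≤ 1 / 10 ^ 40 := by rw [← hm2]; norm_num
  have hRHS : m2 * (2 * C + m2) ≤ 1 / 10 ^ 40 * (2 * C + 1 / 10 ^ 40) :=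
    mul_le_mul hm2small (by linarith) (by linarith) (by norm_num)
  have hCm2sq : C ^ 2 ≤ (C + m2) ^ 2 := pow_le_pow_left₀ hC0 (by linarith) 2
  -- C ≤ 3/4
  have hCle : C ≤ 3 / 4 := by
    by_contra h
    push Not at h
    have h1 : (C + 3 / 4) * (p - 1 / 2) = (C - 3 / 4) / 2 := by linear_combination hR2
    have hp12 : 1 / 2 ≤ p := by
      by_contra hlt
      push Not at hlt
      have hneg : (C + 3 / 4) * (p - 1 / 2) < 0 := mul_neg_of_pos_of_neg (by linarith) (by linarith)
      rw [h1] at hneg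
      linarith
    have hp2 : 1 / 4 ≤ p ^ 2 := by
      have := pow_le_pow_left₀ (by norm_num) hp12 2
      linarith only [this]
    have h3 : 3 / 4 * (C + m2) ^ 2 ≤ 3 * p ^ 2 * (C + m2) ^ 2 :=
      mul_le_mul_of_nonneg_right (by linarith only [hp2]) (sq_nonneg (C + m2))
    have h4 : 3 / 4 * (C + m2) ^ 2 ≤ m2 * (2 * C + m2) := h3.trans hA1
    have hCC : 3 / 4 * C ≤ C ^ 2 := by nlinarith only [h]
    linarith only [h, hCC, hCm2sq, h4, hRHS]
  -- C ≤ 10⁻¹³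
  have hCk : C ≤ 1 / 10 ^ 13 := by
    by_contra h
    push Not at h
    have hCsq : C ^ 2 ≤ 3 / 4 * C := by nlinarith only [hCle, hC0]
    have hp23 : 2 / 3 * C ≤ p := by
      by_contra hlt
      push Not at hlt
      have h1 := mul_lt_mul_of_pos_left hlt (by linarith : (0:ℝ) < C + 3 / 4)
      rw [hR2] at h1
      nlinarith only [h1, hCsq, h]
    have hp2 : (2 / 3 * C) ^ 2 ≤ p ^ 2 := pow_le_pow_left₀ (by linarith) hp23 2
    have h4 : (2 / 3 * C) ^ 2 * C ^ 2 ≤ p ^ 2 * (C + m2) ^ 2 :=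
      mul_le_mul hp2 hCm2sq (sq_nonneg C) (sq_nonneg p)
    have h5 : 4 / 3 * (C ^ 3 * C) ≤ m2 * (2 * C + m2) := by linarith only [h4, hA1]
    have h6 : ((1 : ℝ) / 10 ^ 13) ^ 3 ≤ C ^ 3 := pow_le_pow_left₀ (by positivity) h.le 3
    have h7 : ((1 : ℝ) / 10 ^ 13) ^ 3 * C ≤ C ^ 3 * C := mul_le_mul_of_nonneg_right h6 hC0
    linarith only [h5, h7, hRHS, h]
  -- lower bound on C + m2 from ε ≥ ½ − w:  m2 ≤ 4(C+m2)(w + 4/3·10⁻²⁶)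
  have hp_up : p ≤ 4 / 3 * C := by
    have h := mul_nonneg hC0 hp0
    linarith only [h, hR2]
  have hp2_up : 3 / 4 * p ^ 2 ≤ 4 / 3 * ((1 : ℝ) / 10 ^ 13) ^ 2 := by
    have h1 : p ≤ 4 / 3 * (1 / 10 ^ 13) := hp_up.trans (by linarith only [hCk])
    have h2 := pow_le_pow_left₀ hp0 h1 2
    linarith only [h2]
  have hq_lo : 1 / 4 - q ^ 2 ≤ w + 4 / 3 * ((1 : ℝ) / 10 ^ 13) ^ 2 := by
    linarith only [hlo, hp2_up]
  have hkey : m2 * (C + m2) ≤ 4 * (C + m2) ^ 2 * (1 / 4 - q ^ 2) := by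
    have h1 : 4 * (C + m2) ^ 2 * (1 / 4 - q ^ 2) = m2 * (2 * C + m2) := by
      linear_combination (-4) * hqC
    rw [h1]
    have h2 := mul_nonneg hC0 hm2pos.le
    linarith only [h2]
  have hE : m2 ≤ 4 * (C + m2) * (w + 4 / 3 * ((1 : ℝ) / 10 ^ 13) ^ 2) := by
    have h1 : m2 ≤ 4 * (C + m2) * (1 / 4 - q ^ 2) := by
      have h' : (C + m2) * m2 ≤ (C + m2) * (4 * (C + m2) * (1 / 4 - q ^ 2)) := by
        linarith only [hkey]
      exact le_of_mul_le_mul_left h' hCm2pos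
    exact h1.trans (mul_le_mul_of_nonneg_left hq_lo (by linarith))
  -- hence C + m2 ≤ 1.001·C
  have hD : C + m2 ≤ 1.001 * C := by
    have h1 : 4 * (C + m2) * (w + 4 / 3 * ((1 : ℝ) / 10 ^ 13) ^ 2) ≤
        4 * (C + m2) * (2 / 10 ^ 4 + 4 / 3 * ((1 : ℝ) / 10 ^ 13) ^ 2) :=
      mul_le_mul_of_nonneg_left (by linarith only [hw1]) (by linarith)
    have h2 := hE.trans h1
    nlinarith only [h2, hC0, hm2pos]
  -- so m2/4 = (C+m2)² r² ≤ 1.002001 C² r²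
  have hr_lo : m2 / 4 ≤ 1.002001 * (C ^ 2 * r ^ 2) := by
    have h1 : (C + m2) ^ 2 ≤ (1.001 * C) ^ 2 := pow_le_pow_left₀ hCm2pos.le hD 2
    have h2 := mul_le_mul_of_nonneg_right h1 (sq_nonneg r)
    have h3 : (1.001 * C) ^ 2 * r ^ 2 = 1.002001 * (C ^ 2 * r ^ 2) := by ring
    linarith only [h2, hrC, h3.le, h3.ge]
  -- s ≥ 1 − (4/3)·10⁻¹³, so s² ≥ 0.999
  have hs1 : s ≤ 1 := by
    have h := mul_nonneg hC0 hs0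
    linarith only [h, hR1]
  have hCs : C * s ≤ C := by nlinarith only [hs1, hC0]
  have hs_lo : 1 - 4 / 3 * ((1 : ℝ) / 10 ^ 13) ≤ s := by linarith only [hR1, hCs, hCk]
  have hs2 : 0.999 ≤ s ^ 2 := by nlinarith only [hs_lo]
  -- AM–GM in quadratic form, in the variable K = 10²⁰·C (so that K, s, r are O(1)):
  -- K·r² ≥ 0.75/(4·1.002001·K) and K·s² ≥ 0.999·K, whence K s² + K r² ≥ 0.86
  obtain ⟨K, hK⟩ : ∃ K : ℝ, (10 : ℝ) ^ 20 * C = K := ⟨_, rfl⟩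
  have hK0 : 0 ≤ K := by rw [← hK]; positivity
  have hm2K : m2 = 0.75 / 10 ^ 40 := by rw [← hm2]; norm_num
  have h2K : 0.75 / 4 ≤ 1.002001 * (K ^ 2 * r ^ 2) := by
    have hK2 : K ^ 2 * r ^ 2 = 10 ^ 40 * (C ^ 2 * r ^ 2) := by rw [← hK]; ring
    rw [hK2]
    rw [hm2K] at hr_lo
    linarith only [hr_lo]
  have hgoal : 0.86 ≤ K * s ^ 2 + K * r ^ 2 := by
    by_contra hlt
    push Not at hlt
    nlinarith only [hlt, h2K, hs2, hK0, sq_nonneg r, sq_nonneg (K - 0.4327),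
      mul_nonneg hK0 (sq_nonneg r), mul_nonneg hK0 (by norm_num : (0:ℝ) ≤ 0.999)]
  have hfin : 0.86 / 10 ^ 20 ≤ C * (s ^ 2 + r ^ 2) := by
    have hconv : C * (s ^ 2 + r ^ 2) = (K * s ^ 2 + K * r ^ 2) / 10 ^ 20 := by
      rw [← hK]; ring
    rw [hconv, le_div_iff₀ (by positivity)]
    have h086 : (0.86 : ℝ) / 10 ^ 20 * 10 ^ 20 = 0.86 := by norm_num
    rw [h086]
    exact hgoal
  rw [hθ]
  calc (0.86 : ℝ) / 10 ^ 20 ≤ C * (s ^ 2 + r ^ 2) := hfin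
    _ ≤ C * ‖a‖ ^ 2 := mul_le_mul_of_nonneg_left hsra hC0

/-- **The printed Lemma 1 fails in the model for every `10⁻²⁰ < (εθ)₀ < 1.72·10⁻¹⁵`** (all radii of the printed
window; cf. `printed_lemma1_fails_in_model` for `(εθ)₀ ≤ 10⁻¹⁶`). [cite: Enflo2023, v2 p.7 (choice of u₁), pp.8–9 Lemma 1] -/
theorem printed_lemma1_fails_in_model_all (u₀ u₁ : H) (hu₀ : ‖u₀‖ = 1) (hu₁ : ‖u₁‖ = 1)
    (h01 : ⟪u₀, u₁⟫_ℂ = 0) (hT : ‖Tmodel u₀ u₁‖ < 1) {e₀ : ℝ} (he0 : 1 / 10 ^ 20 < e₀)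
    (he1 : e₀ < 1.72 / 10 ^ 15) :
    ‖Tmodel u₀ u₁‖ ≤ 1 / 10 ^ 20 ∧ ‖adjoint (Tmodel u₀ u₁) u₁‖ < e₀ ∧
    ¬ ∃ (ε : ℝ) (a : ℓ2), 1 / 2 - e₀ / 10 ^ 5 < ε ∧ ε ≤ 1 / 2 ∧
        IsMinimal (V (Tmodel u₀ u₁) hT (yStart u₀)) (xStart u₀ u₁) ε a ∧
        (⟪xStart u₀ u₁ - V (Tmodel u₀ u₁) hT (yStart u₀) a, V (Tmodel u₀ u₁) hT (yStart u₀) a⟫_ℂ).re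
          ≤ e₀ / (2 * 10 ^ 5) := by
  refine ⟨norm_Tmodel_le u₀ u₁ hu₀ hu₁, (norm_adjoint_Tmodel_u₁_le u₀ u₁ hu₀ hu₁).trans_lt he0, ?_⟩
  rintro ⟨ε, a, h1, h2, ha, hθ⟩
  have hw0 : 0 < e₀ / 10 ^ 5 := by positivity
  have hw1 : e₀ / 10 ^ 5 ≤ 2 / 10 ^ 4 := by
    rw [div_le_div_iff₀ (by positivity) (by positivity)]; nlinarith
  have h := model_etheta_lower_all u₀ u₁ hu₀ hu₁ h01 hT hw0 hw1 h1.le h2 a ha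
  have : e₀ / (2 * 10 ^ 5) < 0.86 / 10 ^ 20 := by
    rw [div_lt_div_iff₀ (by positivity) (by positivity)]; nlinarith
  linarith

/-- **Concrete instance on `ℓ²` with `(εθ)₀ = 10⁻¹⁵`.** [cite: Enflo2023, v2 p.7, pp.8–9 Lemma 1] -/
theorem printed_lemma1_fails_on_l2_all :
    ∃ (u₀ u₁ : ℓ2) (hu : ‖Tmodel u₀ u₁‖ < 1), ‖u₀‖ = 1 ∧ ‖u₁‖ = 1 ∧ ⟪u₀, u₁⟫_ℂ = 0 ∧
      ‖Tmodel u₀ u₁‖ ≤ 1 / 10 ^ 20 ∧ ‖adjoint (Tmodel u₀ u₁) u₁‖ < 1 / 10 ^ 15 ∧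
      ¬ ∃ (ε : ℝ) (a : ℓ2), 1 / 2 - (1 / 10 ^ 15) / 10 ^ 5 < ε ∧ ε ≤ 1 / 2 ∧
        IsMinimal (V (Tmodel u₀ u₁) hu (yStart u₀)) (xStart u₀ u₁) ε a ∧
        (⟪xStart u₀ u₁ - V (Tmodel u₀ u₁) hu (yStart u₀) a, V (Tmodel u₀ u₁) hu (yStart u₀) a⟫_ℂ).re
          ≤ (1 / 10 ^ 15) / (2 * 10 ^ 5) := by
  classical
  set u₀ : ℓ2 := lp.single 2 0 (1 : ℂ) with hu₀def
  set u₁ : ℓ2 := lp.single 2 1 (1 : ℂ) with hu₁def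
  have hn₀ : ‖u₀‖ = 1 := by rw [hu₀def, lp.norm_single (by norm_num)]; simp
  have hn₁ : ‖u₁‖ = 1 := by rw [hu₁def, lp.norm_single (by norm_num)]; simp
  have h01 : ⟪u₀, u₁⟫_ℂ = 0 := by
    rw [hu₀def, lp.inner_single_left, hu₁def, lp.single_apply,
      Pi.single_eq_of_ne (by norm_num : (0 : ℕ) ≠ 1), inner_zero_right]
  have hT := norm_Tmodel_lt_one u₀ u₁ hn₀ hn₁
  obtain ⟨h1, h2, h3⟩ := printed_lemma1_fails_in_model_all u₀ u₁ hn₀ hn₁ h01 hT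
    (by norm_num : (1 : ℝ) / 10 ^ 20 < 1 / 10 ^ 15) (by norm_num)
  exact ⟨u₀, u₁, hT, hn₀, hn₁, h01, h1, h2, h3⟩

end Lemma1

end Literature.Analysis.OperatorTheory.Enflo2023
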